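import Mathlib.Data.ZMod.Basic
import Mathlib.Analysis.SpecialFunctions.Pow.Real
import HarnessLib

/-!
# Chessboard estimate on a dyadic torus from reflection Cauchy–Schwarz: the abstract doubling
# argument (Fröhlich–Israel–Lieb–Simon; Friedli–Velenik Theorem 10.11)

Support file for the Theorem 4.3 line of the barrier
`Literature/Barriers/CriticalPhenomena/PositionSpaceRGNonGibbsian.lean` (van Enter–Fernández–Sokal,
J. Stat. Phys. **72** (1993), Theorem 4.3): the low-temperature `+` phase of the internal-spin
system with fully alternating image spins for spacings `b ≥ 3`, which the source obtains from
Pirogov–Sinai theory (§4.3.2, App. B.5.3), is obtained in this line of files from reflection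
positivity and a chessboard–Peierls argument on a torus instead (Fröhlich–Lieb, Comm. Math. Phys.
**60** (1978); Fröhlich–Israel–Lieb–Simon, Comm. Math. Phys. **62** (1978), Thm. 4.1 (chessboard
estimate); Friedli–Velenik 2017, Theorem 10.11; Biskup, LNM 1970 (2009), §5). The present file is the
purely combinatorial/real-analytic core of the chessboard estimate, with NO measure or model in it:

* The index set is the block torus `(ℤ/Nℤ)^d` with `N = 2^(n+1)` blocks per direction; the
  reflection through the block boundary `k` in direction `i` acts on block indices by
  `c ↦ c[i ↦ 2k - 1 - cᵢ]` (`cellReflect`), exchanging the halves `{(cᵢ - k).val < N/2}`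
  (`halfPlus`) and `{N/2 ≤ (cᵢ - k).val}` (`halfMinus`); `symP i k S`, `symM i k S` are the
  symmetrisations `(S ∩ H₊) ∪ θ(S ∩ H₊)`, `(S ∩ H₋) ∪ θ(S ∩ H₋)` of a set `S` of blocks.
* **`chessboard_pow_le`**: if a nonnegative set function `ψ` on sets of blocks satisfies
  `ψ ∅ ≤ 1`, `0 < ψ univ` and the reflection Cauchy–Schwarz inequalities
  `ψ S ^ 2 ≤ ψ (symP i k S) * ψ (symM i k S)` for all `i`, `k`, `S`, then
  `ψ S ^ (N^d) ≤ ψ univ ^ #S` for every `S`; **`chessboard_le_rpow`**: `ψ S ≤ (ψ univ)^(#S/N^d)`.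
  In the application `ψ S` is the probability that all blocks of `S` are "bad", the Cauchy–Schwarz
  inequality is reflection positivity, and `ψ univ ^ (1/N^d)` is the "universal contour" constant.

Proof (the classical extremal argument, FILS 1978 Thm. 4.1 / Biskup 2009 Thm. 5.8 / Friedli–Velenik
proof of Thm. 10.11, here organised as a doubling along each axis, which is why `N` is a power of
two): `Φ S = ψ S ^ (N^d) / ψ univ ^ #S` satisfies `Φ S ^ 2 ≤ Φ (symP S) Φ (symM S)` because
`#symP S + #symM S = 2 #S`; take a maximiser `S*` of `Φ`; if `S* = ∅` the maximum is `ψ ∅ ^ (N^d) ≤ 1`;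
otherwise both symmetrisations of a maximiser are maximisers, and reflecting through the boundary
`t₀ᵢ + 2^j` doubles a run of `2^j` consecutive blocks of a maximiser containing `t₀` into a run of
`2^(j+1)`; after `n+1` doublings in direction `0`, then direction `1`, …, a maximiser equal to `univ`
is reached, so the maximum is `Φ univ = 1`.

Everything is proved; no named facts are introduced (D-0014, D-0026).

## References

* J. Fröhlich, R. Israel, E. H. Lieb, B. Simon, Comm. Math. Phys. 62 (1978) 1–34, Thm. 4.1
  [FrohlichIsraelLiebSimon1978].
* S. Friedli, Y. Velenik, *Statistical Mechanics of Lattice Systems*, CUP 2017, Theorem 10.11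
  [FriedliVelenik2017].
* M. Biskup, *Reflection positivity and phase transitions in lattice spin models*, LNM 1970 (2009),
  §5.2, Thm. 5.8 [Biskup2009].
* A. C. D. van Enter, R. Fernández, A. D. Sokal, J. Stat. Phys. 72 (1993) 879–1167, Theorem 4.3,
  §4.3.2 [VanenterFernandezSokal1993].
-/

noncomputable section

namespace Literature.Barriers.CriticalPhenomena.NonGibbs

open Finset

/-! ### `ℤ/Nℤ` arithmetic of representatives -/

section ZModVal

variable {N : ℕ} [NeZero N]

/-- `(-1 : ℤ/Nℤ).val = N - 1`. [folklore] -/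
theorem zmod_val_neg_one' : ((-1 : ZMod N)).val = N - 1 := by
  obtain ⟨m, rfl⟩ := Nat.exists_eq_succ_of_ne_zero (NeZero.ne N)
  rw [ZMod.val_neg_one, Nat.succ_sub_one]

/-- If `x + y = z` in `ℤ/Nℤ` then `x.val + y.val` is `z.val` or `z.val + N`. [folklore] -/
theorem zmod_val_add_eq_or {x y z : ZMod N} (h : x + y = z) :
    x.val + y.val = z.val ∨ x.val + y.val = z.val + N := by
  have hx := ZMod.val_lt x
  have hy := ZMod.val_lt y
  have hz : z.val = (x.val + y.val) % N := by rw [← h, ZMod.val_add]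
  rcases Nat.lt_or_ge (x.val + y.val) N with hlt | hge
  · left; rw [hz, Nat.mod_eq_of_lt hlt]
  · right
    rw [hz, Nat.mod_eq_sub_mod hge, Nat.mod_eq_of_lt (by omega)]
    omega

/-- `(-v - 1).val = N - 1 - v.val`: the block reflection `cᵢ ↦ 2k - 1 - cᵢ` measured from `k`.
[folklore] -/
theorem zmod_val_neg_sub_one (v : ZMod N) : (-v - 1).val = N - 1 - v.val := by
  have h : v + (-v - 1) = -1 := by ring
  have hv := ZMod.val_lt v
  have hw := ZMod.val_lt (-v - 1)
  rcases zmod_val_add_eq_or h with h' | h' <;> rw [zmod_val_neg_one'] at h' <;> omega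

/-- For `v.val < a ≤ N`: `(v - a).val = N - a + v.val`. [folklore] -/
theorem zmod_val_sub_natCast {v : ZMod N} {a : ℕ} (hva : v.val < a) (haN : a ≤ N) :
    (v - (a : ZMod N)).val = N - a + v.val := by
  have hw := ZMod.val_lt (v - (a : ZMod N))
  rcases Nat.lt_or_ge a N with haN' | haN'
  · have ha : ((a : ZMod N)).val = a := by rw [ZMod.val_natCast, Nat.mod_eq_of_lt haN']
    have h : (v - (a : ZMod N)) + (a : ZMod N) = v := sub_add_cancel v _
    rcases zmod_val_add_eq_or h with h' | h' <;> rw [ha] at h' <;> omega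
  · have haN'' : a = N := le_antisymm haN haN'
    subst haN''
    rw [ZMod.natCast_self, sub_zero]
    omega

/-- For `a < N` and `v.val ≤ a`: `(a - v).val = a - v.val`. [folklore] -/
theorem zmod_val_natCast_sub {v : ZMod N} {a : ℕ} (haN : a < N) (hva : v.val ≤ a) :
    ((a : ZMod N) - v).val = a - v.val := by
  have ha : ((a : ZMod N)).val = a := by rw [ZMod.val_natCast, Nat.mod_eq_of_lt haN]
  have hw := ZMod.val_lt ((a : ZMod N) - v)
  have h : ((a : ZMod N) - v) + v = (a : ZMod N) := sub_add_cancel _ v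
  rcases zmod_val_add_eq_or h with h' | h' <;> rw [ha] at h' <;> omega

omit [NeZero N] in
/-- `v.val < 1 ↔ v = 0`. [folklore] -/
theorem zmod_val_lt_one_iff {v : ZMod N} : v.val < 1 ↔ v = 0 := by
  rw [Nat.lt_one_iff, ZMod.val_eq_zero]

end ZModVal

/-! ### Block reflections of the block torus `(ℤ/Nℤ)^d` and the two halves -/

section Blocks

variable {d N : ℕ}

variable (d N) in
/-- Block indices: the block torus `(ℤ/Nℤ)^d` (blocks `Λ_B + tB`, `t ∈ 𝕋_{L/B}`, of Friedli–Velenik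
§10.2 / the `B`-blocks of Biskup 2009 §5.2). [cite: FriedliVelenik2017, §10.2] -/
abbrev BlockIdx : Type := Fin d → ZMod N

/-- **The action of the reflection through the block boundary `k` in direction `i` on block indices**:
`c ↦ c[i ↦ 2k - 1 - cᵢ]` (a site reflection `xᵢ ↦ 2kB - xᵢ` maps the block `[cᵢB, (cᵢ+1)B]` to the block
`[(2k-1-cᵢ)B, (2k-cᵢ)B]`; Friedli–Velenik §10.2, "`Θ(Λ_B + tB)`"). An involution.
[cite: FriedliVelenik2017, §10.2] -/
def cellReflect (i : Fin d) (k : ZMod N) : BlockIdx d N ≃ BlockIdx d N where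
  toFun c := Function.update c i (2 * k - 1 - c i)
  invFun c := Function.update c i (2 * k - 1 - c i)
  left_inv c := by
    ext j; by_cases h : j = i
    · subst h; simp
    · simp [h]
  right_inv c := by
    ext j; by_cases h : j = i
    · subst h; simp
    · simp [h]

/-- Pointwise formula for `cellReflect`. [cite: FriedliVelenik2017, §10.2] -/
@[simp] theorem cellReflect_apply (i : Fin d) (k : ZMod N) (c : BlockIdx d N) :
    cellReflect i k c = Function.update c i (2 * k - 1 - c i) := rfl

/-- `cellReflect` is an involution. [cite: FriedliVelenik2017, §10.2] -/
theorem cellReflect_cellReflect (i : Fin d) (k : ZMod N) (c : BlockIdx d N) :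
    cellReflect i k (cellReflect i k c) = c :=
  (cellReflect i k).left_inv c

/-- The reflected `i`-th coordinate measured from `k`: `(θc)ᵢ - k = -(cᵢ - k) - 1`.
[cite: FriedliVelenik2017, §10.2] -/
theorem cellReflect_apply_same_sub (i : Fin d) (k : ZMod N) (c : BlockIdx d N) :
    cellReflect i k c i - k = -(c i - k) - 1 := by
  simp only [cellReflect_apply, Function.update_self]; ring

/-- The other coordinates are unchanged. [cite: FriedliVelenik2017, §10.2] -/
theorem cellReflect_apply_of_ne (i : Fin d) (k : ZMod N) (c : BlockIdx d N) {j : Fin d} (h : j ≠ i) :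
    cellReflect i k c j = c j := by
  simp [h]

variable [NeZero N]

variable (N) in
/-- **The positive half of the block torus** for the reflection through the block boundaries `k` and
`k + N/2` in direction `i`: blocks with `(cᵢ - k).val < N/2`, i.e. `cᵢ ∈ {k, …, k + N/2 - 1}`
(the blocks inside the half-torus `𝕋₊`; Friedli–Velenik §10.2–10.3). [cite: FriedliVelenik2017, §10.3] -/
def halfPlus (i : Fin d) (k : ZMod N) : Finset (BlockIdx d N) :=
  univ.filter fun c => (c i - k).val < N / 2

variable (N) in
/-- **The negative half**: blocks with `N/2 ≤ (cᵢ - k).val` (the blocks inside `𝕋₋ = θ𝕋₊`).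
[cite: FriedliVelenik2017, §10.3] -/
def halfMinus (i : Fin d) (k : ZMod N) : Finset (BlockIdx d N) :=
  univ.filter fun c => N / 2 ≤ (c i - k).val

/-- Membership in `halfPlus`. [cite: FriedliVelenik2017, §10.3] -/
@[simp] theorem mem_halfPlus {i : Fin d} {k : ZMod N} {c : BlockIdx d N} :
    c ∈ halfPlus N i k ↔ (c i - k).val < N / 2 := by simp [halfPlus]

/-- Membership in `halfMinus`. [cite: FriedliVelenik2017, §10.3] -/
@[simp] theorem mem_halfMinus {i : Fin d} {k : ZMod N} {c : BlockIdx d N} :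
    c ∈ halfMinus N i k ↔ N / 2 ≤ (c i - k).val := by simp [halfMinus]

/-- The two halves are disjoint. [cite: FriedliVelenik2017, §10.3] -/
theorem disjoint_halfPlus_halfMinus (i : Fin d) (k : ZMod N) :
    Disjoint (halfPlus N i k) (halfMinus N i k) := by
  rw [Finset.disjoint_left]
  intro c hc hc'
  rw [mem_halfPlus] at hc; rw [mem_halfMinus] at hc'; omega

/-- The two halves cover the block torus. [cite: FriedliVelenik2017, §10.3] -/
theorem mem_halfPlus_or_mem_halfMinus (i : Fin d) (k : ZMod N) (c : BlockIdx d N) :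
    c ∈ halfPlus N i k ∨ c ∈ halfMinus N i k := by
  rw [mem_halfPlus, mem_halfMinus]; omega

/-- For even `N` the reflection maps the positive half into the negative half
(`θ𝕋₊ = 𝕋₋` at the level of blocks). [cite: FriedliVelenik2017, §10.3] -/
theorem cellReflect_mem_halfMinus (hN : Even N) {i : Fin d} {k : ZMod N} {c : BlockIdx d N}
    (hc : c ∈ halfPlus N i k) : cellReflect i k c ∈ halfMinus N i k := by
  rw [mem_halfPlus] at hc
  rw [mem_halfMinus, cellReflect_apply_same_sub, zmod_val_neg_sub_one]
  obtain ⟨m, hm⟩ := hN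
  omega

/-- For even `N` the reflection maps the negative half into the positive half.
[cite: FriedliVelenik2017, §10.3] -/
theorem cellReflect_mem_halfPlus (hN : Even N) {i : Fin d} {k : ZMod N} {c : BlockIdx d N}
    (hc : c ∈ halfMinus N i k) : cellReflect i k c ∈ halfPlus N i k := by
  rw [mem_halfMinus] at hc
  rw [mem_halfPlus, cellReflect_apply_same_sub, zmod_val_neg_sub_one]
  have := ZMod.val_lt (c i - k)
  have hN0 : 0 < N := Nat.pos_of_ne_zero (NeZero.ne N)
  obtain ⟨m, hm⟩ := hN
  omega

/-- **Symmetrisation in the positive half**: `(S ∩ H₊) ∪ θ(S ∩ H₊)` — the set of blocks carried by the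
observable `F · (F ∘ θ)`, `F = ∏_{t ∈ S ∩ H₊} f_t`, in the reflection Cauchy–Schwarz step of the proof of
the chessboard estimate. [cite: FriedliVelenik2017, Theorem 10.11 (proof)] -/
def symP (i : Fin d) (k : ZMod N) (S : Finset (BlockIdx d N)) : Finset (BlockIdx d N) :=
  (S ∩ halfPlus N i k) ∪ (S ∩ halfPlus N i k).image (cellReflect i k)

/-- **Symmetrisation in the negative half**: `(S ∩ H₋) ∪ θ(S ∩ H₋)`.
[cite: FriedliVelenik2017, Theorem 10.11 (proof)] -/
def symM (i : Fin d) (k : ZMod N) (S : Finset (BlockIdx d N)) : Finset (BlockIdx d N) :=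
  (S ∩ halfMinus N i k) ∪ (S ∩ halfMinus N i k).image (cellReflect i k)

/-- `#symP S = 2 #(S ∩ H₊)` for even `N`. [cite: FriedliVelenik2017, Theorem 10.11 (proof)] -/
theorem card_symP (hN : Even N) (i : Fin d) (k : ZMod N) (S : Finset (BlockIdx d N)) :
    #(symP i k S) = 2 * #(S ∩ halfPlus N i k) := by
  rw [symP, card_union_of_disjoint, card_image_of_injective _ (cellReflect i k).injective, two_mul]
  rw [Finset.disjoint_left]
  intro c hc hc'
  obtain ⟨c', hc'S, rfl⟩ := mem_image.1 hc'
  have h1 : cellReflect i k c' ∈ halfPlus N i k := (mem_inter.1 hc).2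
  have h2 : cellReflect i k c' ∈ halfMinus N i k := cellReflect_mem_halfMinus hN (mem_inter.1 hc'S).2
  exact Finset.disjoint_left.1 (disjoint_halfPlus_halfMinus i k) h1 h2

/-- `#symM S = 2 #(S ∩ H₋)` for even `N`. [cite: FriedliVelenik2017, Theorem 10.11 (proof)] -/
theorem card_symM (hN : Even N) (i : Fin d) (k : ZMod N) (S : Finset (BlockIdx d N)) :
    #(symM i k S) = 2 * #(S ∩ halfMinus N i k) := by
  rw [symM, card_union_of_disjoint, card_image_of_injective _ (cellReflect i k).injective, two_mul]
  rw [Finset.disjoint_left]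
  intro c hc hc'
  obtain ⟨c', hc'S, rfl⟩ := mem_image.1 hc'
  have h1 : cellReflect i k c' ∈ halfMinus N i k := (mem_inter.1 hc).2
  have h2 : cellReflect i k c' ∈ halfPlus N i k := cellReflect_mem_halfPlus hN (mem_inter.1 hc'S).2
  exact Finset.disjoint_left.1 (disjoint_halfPlus_halfMinus i k) h2 h1

/-- `#symP S + #symM S = 2 #S` for even `N`: the exponents match in the Cauchy–Schwarz step.
[cite: FriedliVelenik2017, Theorem 10.11 (proof)] -/
theorem card_symP_add_card_symM (hN : Even N) (i : Fin d) (k : ZMod N) (S : Finset (BlockIdx d N)) :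
    #(symP i k S) + #(symM i k S) = 2 * #S := by
  rw [card_symP hN, card_symM hN, ← mul_add]
  congr 1
  rw [← card_union_of_disjoint, ← inter_union_distrib_left]
  · congr 1
    exact (inter_eq_left.2 fun c _ => mem_union.2 (mem_halfPlus_or_mem_halfMinus i k c))
  · exact (disjoint_halfPlus_halfMinus i k).mono inter_subset_right inter_subset_right

/-- A block of `S` in the negative half lies in `symM S`. [cite: FriedliVelenik2017, Theorem 10.11 (proof)] -/
theorem mem_symM_of_mem (i : Fin d) (k : ZMod N) {S : Finset (BlockIdx d N)} {c : BlockIdx d N}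
    (hcS : c ∈ S) (hc : c ∈ halfMinus N i k) : c ∈ symM i k S :=
  mem_union_left _ (mem_inter.2 ⟨hcS, hc⟩)

/-- The reflection of a block of `S` in the negative half lies in `symM S`.
[cite: FriedliVelenik2017, Theorem 10.11 (proof)] -/
theorem cellReflect_mem_symM_of_mem (i : Fin d) (k : ZMod N) {S : Finset (BlockIdx d N)}
    {c : BlockIdx d N} (hcS : c ∈ S) (hc : c ∈ halfMinus N i k) : cellReflect i k c ∈ symM i k S :=
  mem_union_right _ (mem_image_of_mem _ (mem_inter.2 ⟨hcS, hc⟩))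

end Blocks

/-! ### Runs of blocks along an axis and their doubling -/

section Runs

variable {d N : ℕ} [NeZero N]

/-- The blocks agreeing with `t₀` in all coordinates of index `≥ m` (free in the first `m`
coordinates): `boxRun t₀ 0 = {t₀}`, `boxRun t₀ d = univ`. [cite: FriedliVelenik2017, Theorem 10.11 (proof)] -/
def boxRun (t₀ : BlockIdx d N) (m : ℕ) : Finset (BlockIdx d N) :=
  univ.filter fun c => ∀ i : Fin d, m ≤ i.val → c i = t₀ i

/-- A run of `2^j` consecutive blocks in direction `i` starting at `t₀`, free in the coordinates of
index `< i`, fixed to `t₀` in those of index `> i`. [cite: FriedliVelenik2017, Theorem 10.11 (proof)] -/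
def axisRun (t₀ : BlockIdx d N) (i : Fin d) (j : ℕ) : Finset (BlockIdx d N) :=
  univ.filter fun c => (∀ i' : Fin d, i.val < i'.val → c i' = t₀ i') ∧ (c i - t₀ i).val < 2 ^ j

/-- Membership in `boxRun`. [folklore] -/
@[simp] theorem mem_boxRun {t₀ : BlockIdx d N} {m : ℕ} {c : BlockIdx d N} :
    c ∈ boxRun t₀ m ↔ ∀ i : Fin d, m ≤ i.val → c i = t₀ i := by simp [boxRun]

/-- Membership in `axisRun`. [folklore] -/
@[simp] theorem mem_axisRun {t₀ : BlockIdx d N} {i : Fin d} {j : ℕ} {c : BlockIdx d N} :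
    c ∈ axisRun t₀ i j ↔ (∀ i' : Fin d, i.val < i'.val → c i' = t₀ i') ∧ (c i - t₀ i).val < 2 ^ j := by
  simp [axisRun]

/-- `boxRun t₀ 0 = {t₀}`. [folklore] -/
theorem boxRun_zero (t₀ : BlockIdx d N) : boxRun t₀ 0 = {t₀} := by
  ext c
  simp only [mem_boxRun, zero_le, forall_const, mem_singleton]
  exact ⟨fun h => funext h, fun h i => by rw [h]⟩

/-- `boxRun t₀ d = univ`. [folklore] -/
theorem boxRun_eq_univ (t₀ : BlockIdx d N) : boxRun t₀ d = univ := by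
  ext c
  simp only [mem_boxRun, mem_univ, iff_true]
  intro i hi
  exact absurd i.isLt (not_lt.2 hi)

/-- The run of length `1` in direction `i` is the box fixed from `i` on: `axisRun t₀ i 0 = boxRun t₀ i`.
[folklore] -/
theorem axisRun_zero (t₀ : BlockIdx d N) (i : Fin d) : axisRun t₀ i 0 = boxRun t₀ i.val := by
  ext c
  simp only [mem_axisRun, pow_zero, zmod_val_lt_one_iff, sub_eq_zero, mem_boxRun]
  constructor
  · rintro ⟨h1, h2⟩ i' hi'
    rcases (Nat.lt_or_ge i.val i'.val) with h | h
    · exact h1 i' h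
    · have : i' = i := Fin.ext (le_antisymm h hi')
      rw [this, h2]
  · intro h
    exact ⟨fun i' hi' => h i' hi'.le, h i le_rfl⟩

/-- The full run in direction `i` is the box fixed from `i+1` on: for `N ≤ 2^j`,
`axisRun t₀ i j = boxRun t₀ (i+1)`. [folklore] -/
theorem axisRun_of_le {j : ℕ} (hj : N ≤ 2 ^ j) (t₀ : BlockIdx d N) (i : Fin d) :
    axisRun t₀ i j = boxRun t₀ (i.val + 1) := by
  ext c
  simp only [mem_axisRun, mem_boxRun]
  constructor
  · rintro ⟨h1, -⟩ i' hi'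
    exact h1 i' hi'
  · intro h
    exact ⟨fun i' hi' => h i' hi', (ZMod.val_lt _).trans_le hj⟩

/-- **A run of `2^j ≤ N/2` blocks lies in the negative half of the reflection through the block
boundary `t₀ᵢ + 2^j`.** [cite: FriedliVelenik2017, Theorem 10.11 (proof)] -/
theorem axisRun_subset_halfMinus {j : ℕ} (hj : 2 ^ j ≤ N / 2) (t₀ : BlockIdx d N) (i : Fin d) :
    axisRun t₀ i j ⊆ halfMinus N i (t₀ i + ((2 ^ j : ℕ) : ZMod N)) := by
  intro c hc
  rw [mem_axisRun] at hc
  rw [mem_halfMinus]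
  have h2N : 2 ^ j ≤ N := hj.trans (Nat.div_le_self N 2)
  have hv : (c i - (t₀ i + ((2 ^ j : ℕ) : ZMod N))).val = N - 2 ^ j + (c i - t₀ i).val := by
    rw [show c i - (t₀ i + ((2 ^ j : ℕ) : ZMod N)) = (c i - t₀ i) - ((2 ^ j : ℕ) : ZMod N) by ring]
    exact zmod_val_sub_natCast hc.2 h2N
  rw [hv]
  omega

/-- **Doubling**: the run of `2^(j+1)` blocks is contained in the run of `2^j` blocks together with its
reflection through the block boundary `t₀ᵢ + 2^j` (for `2^(j+1) ≤ N`).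
[cite: FriedliVelenik2017, Theorem 10.11 (proof)] -/
theorem mem_axisRun_succ {j : ℕ} (hj : 2 ^ (j + 1) ≤ N) {t₀ : BlockIdx d N} {i : Fin d}
    {c : BlockIdx d N} (hc : c ∈ axisRun t₀ i (j + 1)) :
    c ∈ axisRun t₀ i j ∨ cellReflect i (t₀ i + ((2 ^ j : ℕ) : ZMod N)) c ∈ axisRun t₀ i j := by
  rw [mem_axisRun] at hc
  obtain ⟨h1, h2⟩ := hc
  by_cases hlt : (c i - t₀ i).val < 2 ^ j
  · exact Or.inl (mem_axisRun.2 ⟨h1, hlt⟩)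
  · right
    rw [mem_axisRun]
    refine ⟨fun i' hi' => ?_, ?_⟩
    · rw [cellReflect_apply_of_ne _ _ _ (fun h => by rw [h] at hi'; exact lt_irrefl _ hi'), h1 i' hi']
    · have hval : (cellReflect i (t₀ i + ((2 ^ j : ℕ) : ZMod N)) c i - t₀ i) =
          ((2 ^ (j + 1) - 1 : ℕ) : ZMod N) - (c i - t₀ i) := by
        simp only [cellReflect_apply, Function.update_self]
        have : ((2 ^ (j + 1) - 1 : ℕ) : ZMod N) = 2 * ((2 ^ j : ℕ) : ZMod N) - 1 := by
          rw [Nat.cast_sub Nat.one_le_two_pow, pow_succ]; push_cast; ring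
        rw [this]; ring
      rw [hval, zmod_val_natCast_sub (by omega) (by omega)]
      rw [pow_succ] at h2
      omega

end Runs

/-! ### The extremal (doubling) argument -/

section Chessboard

variable {d N : ℕ} [NeZero N]

/-- The normalised functional `Φ S = ψ S ^ (N^d) / ψ univ ^ #S` of the extremal argument.
[cite: FriedliVelenik2017, Theorem 10.11 (proof)] -/
def chessPhi (ψ : Finset (BlockIdx d N) → ℝ) (S : Finset (BlockIdx d N)) : ℝ :=
  ψ S ^ (N ^ d) / ψ univ ^ #S

/-- `Φ univ = 1` (as `#univ = N^d`). [cite: FriedliVelenik2017, Theorem 10.11 (proof)] -/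
theorem chessPhi_univ {ψ : Finset (BlockIdx d N) → ℝ} (h1 : 0 < ψ univ) : chessPhi ψ univ = 1 := by
  rw [chessPhi, card_univ, Fintype.card_pi, Finset.prod_const, ZMod.card, card_univ,
    Fintype.card_fin, div_self (pow_ne_zero _ h1.ne')]

/-- **The Cauchy–Schwarz inequality passes to `Φ`**: `Φ S ^ 2 ≤ Φ (symP S) Φ (symM S)`, because
`#symP S + #symM S = 2#S`. [cite: FriedliVelenik2017, Theorem 10.11 (proof)] -/
theorem chessPhi_sq_le (hN : Even N) {ψ : Finset (BlockIdx d N) → ℝ} (h1 : 0 < ψ univ)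
    (hcs : ∀ (i : Fin d) (k : ZMod N) (S : Finset (BlockIdx d N)),
      ψ S ^ 2 ≤ ψ (symP i k S) * ψ (symM i k S))
    (i : Fin d) (k : ZMod N) (S : Finset (BlockIdx d N)) :
    chessPhi ψ S ^ 2 ≤ chessPhi ψ (symP i k S) * chessPhi ψ (symM i k S) := by
  have hpow : (ψ S ^ N ^ d) ^ 2 ≤ ψ (symP i k S) ^ N ^ d * ψ (symM i k S) ^ N ^ d := by
    rw [← pow_mul, mul_comm, pow_mul, ← mul_pow]
    exact pow_le_pow_left₀ (sq_nonneg _) (hcs i k S) _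
  have hden : ψ univ ^ #(symP i k S) * ψ univ ^ #(symM i k S) = (ψ univ ^ #S) ^ 2 := by
    rw [← pow_add, card_symP_add_card_symM hN, pow_mul', ]
  simp only [chessPhi, div_pow]
  rw [div_mul_div_comm, hden]
  exact div_le_div_of_nonneg_right hpow (by positivity)

/-- **Both symmetrisations of a maximiser of `Φ` are maximisers.**
[cite: FriedliVelenik2017, Theorem 10.11 (proof)] -/
theorem chessPhi_symM_eq_of_isMax (hN : Even N) {ψ : Finset (BlockIdx d N) → ℝ} (h0 : ∀ S, 0 ≤ ψ S)
    (h1 : 0 < ψ univ)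
    (hcs : ∀ (i : Fin d) (k : ZMod N) (S : Finset (BlockIdx d N)),
      ψ S ^ 2 ≤ ψ (symP i k S) * ψ (symM i k S))
    {M : ℝ} (hMpos : 0 < M) (hmax : ∀ S, chessPhi ψ S ≤ M) {S : Finset (BlockIdx d N)}
    (hS : chessPhi ψ S = M) (i : Fin d) (k : ZMod N) :
    chessPhi ψ (symM i k S) = M := by
  have hP0 : 0 ≤ chessPhi ψ (symP i k S) := by
    unfold chessPhi; exact div_nonneg (pow_nonneg (h0 _) _) (pow_nonneg h1.le _)
  have hM0 : 0 ≤ chessPhi ψ (symM i k S) := by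
    unfold chessPhi; exact div_nonneg (pow_nonneg (h0 _) _) (pow_nonneg h1.le _)
  have h := chessPhi_sq_le hN h1 hcs i k S
  rw [hS] at h
  have hPle := hmax (symP i k S)
  refine le_antisymm (hmax _) ?_
  by_contra hlt
  rw [not_le] at hlt
  have h1' : chessPhi ψ (symP i k S) * chessPhi ψ (symM i k S) ≤ M * chessPhi ψ (symM i k S) :=
    mul_le_mul_of_nonneg_right hPle hM0
  have h2' : M * chessPhi ψ (symM i k S) < M * M := mul_lt_mul_of_pos_left hlt hMpos
  nlinarith

/-- **Doubling a run inside a maximiser**: if a maximiser contains `axisRun t₀ i j` with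
`2^(j+1) ≤ N`, some maximiser contains `axisRun t₀ i (j+1)`.
[cite: FriedliVelenik2017, Theorem 10.11 (proof)] -/
theorem exists_isMax_axisRun_succ (hN : Even N) {ψ : Finset (BlockIdx d N) → ℝ} (h0 : ∀ S, 0 ≤ ψ S)
    (h1 : 0 < ψ univ)
    (hcs : ∀ (i : Fin d) (k : ZMod N) (S : Finset (BlockIdx d N)),
      ψ S ^ 2 ≤ ψ (symP i k S) * ψ (symM i k S))
    {M : ℝ} (hMpos : 0 < M) (hmax : ∀ S, chessPhi ψ S ≤ M) {t₀ : BlockIdx d N} {i : Fin d} {j : ℕ}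
    (hj : 2 ^ (j + 1) ≤ N) {S : Finset (BlockIdx d N)} (hS : chessPhi ψ S = M)
    (hrun : axisRun t₀ i j ⊆ S) :
    ∃ S' : Finset (BlockIdx d N), chessPhi ψ S' = M ∧ axisRun t₀ i (j + 1) ⊆ S' := by
  set k : ZMod N := t₀ i + ((2 ^ j : ℕ) : ZMod N) with hk
  have hj' : 2 ^ j ≤ N / 2 := by
    rw [pow_succ] at hj; omega
  refine ⟨symM i k S, chessPhi_symM_eq_of_isMax hN h0 h1 hcs hMpos hmax hS i k, fun c hc => ?_⟩
  rcases mem_axisRun_succ hj hc with h | h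
  · exact mem_symM_of_mem i k (hrun h) (axisRun_subset_halfMinus hj' t₀ i h)
  · have := cellReflect_mem_symM_of_mem i k (hrun h) (axisRun_subset_halfMinus hj' t₀ i h)
    rwa [cellReflect_cellReflect] at this

/-- **Growing a maximiser along one axis**: with `N = 2^(n+1)`, if a maximiser contains
`boxRun t₀ i` then some maximiser contains `boxRun t₀ (i+1)` (after `n+1` doublings).
[cite: FriedliVelenik2017, Theorem 10.11 (proof)] -/
theorem exists_isMax_boxRun_succ {n : ℕ} (hNn : N = 2 ^ (n + 1)) {ψ : Finset (BlockIdx d N) → ℝ}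
    (h0 : ∀ S, 0 ≤ ψ S) (h1 : 0 < ψ univ)
    (hcs : ∀ (i : Fin d) (k : ZMod N) (S : Finset (BlockIdx d N)),
      ψ S ^ 2 ≤ ψ (symP i k S) * ψ (symM i k S))
    {M : ℝ} (hMpos : 0 < M) (hmax : ∀ S, chessPhi ψ S ≤ M) {t₀ : BlockIdx d N} (i : Fin d)
    {S : Finset (BlockIdx d N)} (hS : chessPhi ψ S = M) (hbox : boxRun t₀ i.val ⊆ S) :
    ∃ S' : Finset (BlockIdx d N), chessPhi ψ S' = M ∧ boxRun t₀ (i.val + 1) ⊆ S' := by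
  have hN : Even N := hNn ▸ Nat.even_pow.2 ⟨even_two, Nat.succ_ne_zero n⟩
  -- `j` doublings, `j ≤ n + 1`
  have key : ∀ j : ℕ, j ≤ n + 1 → ∃ S' : Finset (BlockIdx d N), chessPhi ψ S' = M ∧ axisRun t₀ i j ⊆ S' := by
    intro j
    induction j with
    | zero => exact fun _ => ⟨S, hS, by rw [axisRun_zero]; exact hbox⟩
    | succ j ih =>
      intro hj
      obtain ⟨S', hS', hrun⟩ := ih (Nat.le_of_succ_le hj)
      have h2 : 2 ^ (j + 1) ≤ N := by
        rw [hNn]; exact Nat.pow_le_pow_right (by norm_num) hj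
      exact exists_isMax_axisRun_succ hN h0 h1 hcs hMpos hmax h2 hS' hrun
  obtain ⟨S', hS', hrun⟩ := key (n + 1) le_rfl
  exact ⟨S', hS', by rw [← axisRun_of_le hNn.le t₀ i]; exact hrun⟩

/-- **The chessboard estimate, power form** (Fröhlich–Israel–Lieb–Simon 1978, Thm. 4.1; Friedli–Velenik
Theorem 10.11; Biskup 2009, Thm. 5.8 — abstract doubling form on the dyadic block torus `(ℤ/Nℤ)^d`,
`N = 2^(n+1)`): if `ψ ≥ 0`, `ψ ∅ ≤ 1`, `ψ univ > 0` and `ψ S ^ 2 ≤ ψ (symP i k S) ψ (symM i k S)` for all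
block reflections and all `S`, then `ψ S ^ (N^d) ≤ ψ univ ^ #S`.
[cite: FriedliVelenik2017, Theorem 10.11] -/
theorem chessboard_pow_le {n : ℕ} (hNn : N = 2 ^ (n + 1)) {ψ : Finset (BlockIdx d N) → ℝ}
    (h0 : ∀ S, 0 ≤ ψ S) (hempty : ψ ∅ ≤ 1) (h1 : 0 < ψ univ)
    (hcs : ∀ (i : Fin d) (k : ZMod N) (S : Finset (BlockIdx d N)),
      ψ S ^ 2 ≤ ψ (symP i k S) * ψ (symM i k S))
    (S : Finset (BlockIdx d N)) : ψ S ^ (N ^ d) ≤ ψ univ ^ #S := by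
  classical
  -- a maximiser of `Φ`
  obtain ⟨Smax, -, hSmax⟩ :=
    Finset.exists_max_image (univ : Finset (Finset (BlockIdx d N))) (chessPhi ψ) ⟨∅, mem_univ _⟩
  set M := chessPhi ψ Smax with hM
  have hmax : ∀ T, chessPhi ψ T ≤ M := fun T => hSmax T (mem_univ T)
  have hM1 : 1 ≤ M := by rw [← chessPhi_univ h1]; exact hmax _
  have hMpos : 0 < M := one_pos.trans_le hM1
  -- the maximum is at most `1`
  have hMle : M ≤ 1 := by
    by_cases hne : Smax = ∅
    · rw [hM, hne, chessPhi, card_empty, pow_zero, div_one]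
      exact pow_le_one₀ (h0 _) hempty
    · obtain ⟨t₀, ht₀⟩ := Finset.nonempty_iff_ne_empty.2 hne
      -- grow the maximiser to `univ`
      have grow : ∀ m : ℕ, m ≤ d → ∃ S' : Finset (BlockIdx d N), chessPhi ψ S' = M ∧ boxRun t₀ m ⊆ S' := by
        intro m
        induction m with
        | zero =>
          exact fun _ => ⟨Smax, rfl, by rw [boxRun_zero]; exact singleton_subset_iff.2 ht₀⟩
        | succ m ih =>
          intro hm
          obtain ⟨S', hS', hbox⟩ := ih (Nat.le_of_succ_le hm)
          exact exists_isMax_boxRun_succ hNn h0 h1 hcs hMpos hmax ⟨m, hm⟩ hS' hbox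
      obtain ⟨S', hS', hbox⟩ := grow d le_rfl
      rw [boxRun_eq_univ] at hbox
      have : S' = univ := univ_subset_iff.1 hbox
      rw [← hS', this, chessPhi_univ h1]
  -- conclude
  have hS : chessPhi ψ S ≤ 1 := (hmax S).trans hMle
  rw [chessPhi, div_le_one (pow_pos h1 _)] at hS
  exact hS

/-- **The chessboard estimate** in the usual form `ψ S ≤ (ψ univ) ^ (#S / N^d)` (the right-hand side is
`∏_{t ∈ S} ‖f‖` with the "universal contour" constant `‖f‖ = ψ(univ)^{1/|𝕋_B|}` of Friedli–Velenik
(10.20)/(10.21) when all `f_t` are equal). [cite: FriedliVelenik2017, Theorem 10.11] -/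
theorem chessboard_le_rpow {n : ℕ} (hNn : N = 2 ^ (n + 1)) {ψ : Finset (BlockIdx d N) → ℝ}
    (h0 : ∀ S, 0 ≤ ψ S) (hempty : ψ ∅ ≤ 1) (h1 : 0 < ψ univ)
    (hcs : ∀ (i : Fin d) (k : ZMod N) (S : Finset (BlockIdx d N)),
      ψ S ^ 2 ≤ ψ (symP i k S) * ψ (symM i k S))
    (S : Finset (BlockIdx d N)) : ψ S ≤ ψ univ ^ ((#S : ℝ) / (N : ℝ) ^ d) := by
  have hNd : (0 : ℝ) < (N : ℝ) ^ d := by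
    have : (0 : ℝ) < N := by exact_mod_cast Nat.pos_of_ne_zero (NeZero.ne N)
    positivity
  have h := chessboard_pow_le hNn h0 hempty h1 hcs S
  -- take `N^d`-th roots
  have hroot : ψ S = (ψ S ^ (N ^ d)) ^ ((1 : ℝ) / (N : ℝ) ^ d) := by
    rw [← Real.rpow_natCast, ← Real.rpow_mul (h0 S)]
    push_cast
    rw [mul_one_div_cancel hNd.ne', Real.rpow_one]
  rw [hroot]
  calc (ψ S ^ N ^ d) ^ ((1 : ℝ) / (N : ℝ) ^ d)
      ≤ (ψ univ ^ #S) ^ ((1 : ℝ) / (N : ℝ) ^ d) :=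
        Real.rpow_le_rpow (pow_nonneg (h0 S) _) h (by positivity)
    _ = ψ univ ^ ((#S : ℝ) / (N : ℝ) ^ d) := by
        rw [← Real.rpow_natCast, ← Real.rpow_mul h1.le]
        congr 1
        ring

/-- **The chessboard estimate with an explicit constant**: if moreover `ψ univ ≤ ε ^ (N^d)` for some
`ε ≥ 0` (a bound on the "universal contour"), then `ψ S ≤ ε ^ #S` for every `S` — the form
`μ(⋂_{t ∈ S} bad_t) ≤ ε^{|S|}` used in chessboard–Peierls arguments (Fröhlich–Lieb 1978; Biskup 2009,
§5.3). [cite: FriedliVelenik2017, Theorem 10.11] -/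
theorem chessboard_le_pow_of_le {n : ℕ} (hNn : N = 2 ^ (n + 1)) {ψ : Finset (BlockIdx d N) → ℝ}
    (h0 : ∀ S, 0 ≤ ψ S) (hempty : ψ ∅ ≤ 1) (h1 : 0 < ψ univ)
    (hcs : ∀ (i : Fin d) (k : ZMod N) (S : Finset (BlockIdx d N)),
      ψ S ^ 2 ≤ ψ (symP i k S) * ψ (symM i k S))
    {ε : ℝ} (hε : 0 ≤ ε) (huniv : ψ univ ≤ ε ^ (N ^ d)) (S : Finset (BlockIdx d N)) :
    ψ S ≤ ε ^ #S := by
  have h := chessboard_pow_le hNn h0 hempty h1 hcs S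
  have h' : ψ S ^ (N ^ d) ≤ (ε ^ #S) ^ (N ^ d) := by
    calc ψ S ^ (N ^ d) ≤ ψ univ ^ #S := h
      _ ≤ (ε ^ (N ^ d)) ^ #S := pow_le_pow_left₀ h1.le huniv _
      _ = (ε ^ #S) ^ (N ^ d) := by rw [← pow_mul, ← pow_mul, mul_comm]
  have hNd : N ^ d ≠ 0 := pow_ne_zero _ (NeZero.ne N)
  exact (pow_le_pow_iff_left₀ (h0 S) (pow_nonneg hε _) hNd).1 h'

end Chessboard

end Literature.Barriers.CriticalPhenomena.NonGibbs

end
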